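import Summits.NavierStokesRegularity.NavierStokesRegularity.Theses.HodographBetchov
import Summits.NavierStokesRegularity.NavierStokesRegularity.Theorems.HodographBetchovSlowClassProductionLifespan
import Summits.NavierStokesRegularity.NavierStokesRegularity.Theorems.HodographBetchovSlowClassProductionDeepVorticity
import Literature.Analysis.FluidPDE.ConstantinDirectionDissipationProofs
import HarnessLib.Audit

/-!
# `SlowClassProduction` (stmt-NavierStokesRegularity-15831) — alternative line `Lines/near_field.lean`

Route `HodographBetchov`, crux 2 (rank 2).  STRATEGIST LINE "localisation to the near-field final
layer at the lifespan" (published alongside the live skeleton `Lines/birth.lean`, which it does not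
touch; it REUSES the three theorems the live line has already landed in tree).

The crux asks, for every classical Leray–Hopf solution `(u,p)` on `ℝ³ × [0,T)` from a rapidly
decaying datum and every speed level `l > 0`, for a bound `∫_{S_t} P ≤ C` uniform in `t < T` on
the enstrophy production `P = ⟪ω, ∇u ω⟫` over the slow class `S_t = {0 < s < t, |u| ≤ l}`.

Tree theorems used BY NAME in the glue (all sorry-free, landed 2026-08-17 by the live line):
* `Theorems.SlowClassProduction.slowClassProduction_iff_maximal` — the crux is EQUIVALENT to its
  restriction to MAXIMAL smooth solutions (`IsMaximalSmoothSolution ν 0 u p T`: `T` is the lifespan);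
* `Theorems.SlowClassProduction.Birth.stub_slabProduction` — production is absolutely integrable on
  every sub-slab `(0,t₁) × ℝ³`, `t₁ < T` (the live line's stub 1, LANDED): the EARLY piece;
* `Theorems.SlowClassProduction.Birth.norm_curl_le_of_slow_cylinder` — Serrin's quantitative bound
  at ANY level: `|u| ≤ L` on a backward `(r²/ν, r)`-cylinder ⇒ `‖ω‖ ≤ K(ν,L,r,D)` at its tip;
* `IsLerayHopfOn.lintegral_frobeniusNormSq_fderiv_of_classical` — finite dissipation `D`.

Stubs of THIS line (3):
* `stub_curlBoundedProduction` (KNOWN, M): on any set of slab points where `‖ω‖ ≤ K` the production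
  is absolutely integrable with `∫ |P| ≤ C(u,K)` (`|P| ≤ ‖∇u‖‖ω‖² ≤ K‖curlCLM‖ |∇u|_F²`,
  majorant integrable on the slab by finite dissipation — verbatim the domination step of the landed
  `stub_deepSlowProduction`, with an arbitrary set `E` in place of the deep piece).
* `stub_farFieldVelocity` (KNOWN-IN-SUBSTANCE, L): far-field regularity up to the lifespan —
  `|u(t,x)| ≤ L` for `T − h ≤ t < T`, `‖x‖ ≥ R` (CKN ε-regularity at infinity; tree:
  `leray_solution_farField_bound_holds` PROVED for local Leray solutions + identification of the
  classical Leray–Hopf solution with the local Leray / Kato solution from `u 0`, a.e. → everywhere by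
  continuity).  With `norm_curl_le_of_slow_cylinder` (glue) and stub 1 it pays for the FAR piece.
* `stub_nearFieldSlowProductionMaximal` (OPEN — the content of the crux, localised; hardest): for a
  MAXIMAL smooth solution with lifespan `T` (a genuine first blow-up time — free, by
  `slowClassProduction_iff_maximal`), every level `l`, layer `h ∈ (0,T)` and radius `R`: the
  production is ABSOLUTELY integrable on the slow class inside the near-field final layer
  `{T−h ≤ s} × {‖x‖ < R}` with `∫ |P| ≤ C` uniformly in `t < T`.  By compactness of `B̄(0,R)` this is
  its germ form at each point `(x₀,T)`; trivial at CKN-regular points, so only the compact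
  `𝒫¹`-null singular set `Σ_T ≠ ∅` matters.  Absolute value: every heuristic for the crux is
  absolute, and absoluteness makes the statement closed under restriction (collar / steep-gradient
  / per-point cuts are free reshapes); the route spends the Betchov sign only on the fast class.

Glue (`maximalCase_of_stubs`, sorry-free): `(h,R,L)` from stub 2; `r := √(ν h/2)` so `r²/ν = h/2`;
`K` from `norm_curl_le_of_slow_cylinder` at level `L`, radius `r`; `C₂` from stub 1 at `K`; `C₄`
from stub 3 at `(l, h/2, R + r)`; `C₀ := ∫∫_{(0,T−h/2)×ℝ³}|P|` from the landed slab theorem; split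
`S_t = (S_t ∩ {s < T−h/2}) ∪ ((S_t ∖ …) ∩ {‖x‖ < R+r}) ∪ ((S_t ∖ …) ∖ {‖x‖ < R+r})`
(`integral_inter_add_sdiff` twice); on the far piece every backward `(h/2, r)`-cylinder lies in
`[T−h,T) × {‖y‖ ≥ R}`, so `‖ω‖ ≤ K` there; `∫_{S_t} P ≤ C₀ + C₄ + C₂`.  `SlowClassProduction_of`
= `slowClassProduction_iff_maximal.mpr (maximalCase_of_stubs stub… stub… stub…)`, the crux BY NAME.

Disproof used: none exists (`ledger crux ls`: no `Disproof.lean`, no Negative lemma, 2026-08-17);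
negatives index (4055, 1832, 1429, 0154) unrelated; no stub is an instance of a refuted statement.
Convergent crux ideas filed independently while this line was built (ideator 2,
`Ideas/hyperfast-shadow-germ.md`, `Ideas/type-one-stagnation-census.md`) argue for exactly this
localisation and supply the Type-I attack on stub 3; see the line card.

Sources: CKN1982, LemarieRieusset2016 (Thm 14.4, proof of Thm 14.5), BradshawTsai2020 (§1
far-field regularity), Serrin1962 / RobinsonRodrigoSadowskiCUP2016 Thm 13.7, Tao2011 Cor. 11.1,
KNSS2009, Seregin2014; route file `Theses/HodographBetchov.lean`; live line `Lines/birth.lean`;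
census `STRATEGY-CENSUS.md`.
-/

noncomputable section

-- the summit and its single problem share the name `NavierStokesRegularity` (D-0017 nested layout)
set_option linter.dupNamespace false

namespace Summit.NavierStokesRegularity.NavierStokesRegularity.Cruxes.SlowClassProduction.NearField

open Set MeasureTheory Metric
open scoped ContDiff

/-! ## Stubs -/

/-- STUB 1 (KNOWN, M in Lean).  **Vorticity-bounded regions carry an absolute production budget.**
For a classical Navier–Stokes solution (`f = 0`) on `ℝ³ × [0,T)` that is Leray–Hopf from a rapidly
decaying datum and every `K` there is `C` such that on EVERY set `E` of slab points at which
`‖curl u‖ ≤ K` the production is integrable with `∫_E |P| ≤ C`.  Mechanism (= the domination step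
of the landed `Theorems.SlowClassProduction.Birth.stub_deepSlowProduction`):
`|⟪ω, ∇u ω⟫| ≤ ‖∇u‖‖ω‖² ≤ K ‖curlCLM‖ |∇u|_F²` pointwise, the majorant is integrable on
`(0,T) × ℝ³` by finite dissipation (`IsLerayHopfOn.lintegral_frobeniusNormSq_fderiv_of_classical`,
Tonelli), the superset `{z ∈ (0,T) × ℝ³ : ‖curl (u z.1) z.2‖ ≤ K}` is relatively closed in the open
slab (joint continuity of `curl u`, `SpaceTimeCalculusC1`), then `IntegrableOn.mono_set` /
`setIntegral_mono_set` pass to the arbitrary subset `E`. [Leray1934, Constantin1990] -/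
theorem stub_curlBoundedProduction :
    ∀ (ν T : ℝ), 0 < ν → 0 < T →
      ∀ (u : ℝ → EuclideanSpace ℝ (Fin 3) → EuclideanSpace ℝ (Fin 3))
        (p : ℝ → EuclideanSpace ℝ (Fin 3) → ℝ),
        Literature.Analysis.FluidPDE.IsClassicalNSSolutionOn (Set.Ico 0 T) ν 0 u p →
        Literature.Analysis.FluidPDE.IsLerayHopfOn T ν 0 (u 0) u →
        Literature.Analysis.FluidPDE.HasRapidSpatialDecay (u 0) →
        ∀ K : ℝ, ∃ C : ℝ, ∀ E : Set (ℝ × EuclideanSpace ℝ (Fin 3)),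
          (∀ z ∈ E, z.1 ∈ Set.Ioo 0 T ∧ ‖Literature.Analysis.FluidPDE.curl (u z.1) z.2‖ ≤ K) →
            MeasureTheory.IntegrableOn
              (fun z : ℝ × EuclideanSpace ℝ (Fin 3) =>
                inner ℝ (Literature.Analysis.FluidPDE.curl (u z.1) z.2)
                  (fderiv ℝ (u z.1) z.2 (Literature.Analysis.FluidPDE.curl (u z.1) z.2))) E ∧
            ∫ z in E, |inner ℝ (Literature.Analysis.FluidPDE.curl (u z.1) z.2)
                (fderiv ℝ (u z.1) z.2 (Literature.Analysis.FluidPDE.curl (u z.1) z.2))| ≤ C := by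
  sorry

/-- STUB 2 (KNOWN-IN-SUBSTANCE, L in Lean).  **Far-field velocity bound up to the final time.**
Same class; there are a layer thickness `h ∈ (0,T)`, a radius `R` and a bound `L` with
`‖u(t,x)‖ ≤ L` for all `T − h ≤ t < T` and `‖x‖ ≥ R`.  Mechanism: the (global) local Leray
solution `w` from the datum `u 0 ∈ L² ∩ L³` is essentially bounded on `(T/2, 2T) × {‖x‖ > R}`
(CKN ε-regularity in the far field — Lemarié-Rieusset 2016, proof of Thm 14.5 with Thm 14.4;
Bradshaw–Tsai 2020 §1; tree: `leray_solution_farField_bound_holds`, PROVED); the classical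
Leray–Hopf solution `u` coincides with `w` a.e. on `(0,T) × ℝ³` (weak–strong uniqueness through the
Kato solution, which cannot blow up before `T`: Tao persistence on closed sub-slabs +
`leray_solution_ae_eq_kato`); `u` is continuous, so the a.e. bound holds everywhere.
[CKN1982, LemarieRieusset2016, BradshawTsai2020, Leray1934] -/
theorem stub_farFieldVelocity :
    ∀ (ν T : ℝ), 0 < ν → 0 < T →
      ∀ (u : ℝ → EuclideanSpace ℝ (Fin 3) → EuclideanSpace ℝ (Fin 3))
        (p : ℝ → EuclideanSpace ℝ (Fin 3) → ℝ),
        Literature.Analysis.FluidPDE.IsClassicalNSSolutionOn (Set.Ico 0 T) ν 0 u p →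
        Literature.Analysis.FluidPDE.IsLerayHopfOn T ν 0 (u 0) u →
        Literature.Analysis.FluidPDE.HasRapidSpatialDecay (u 0) →
        ∃ h : ℝ, 0 < h ∧ h < T ∧ ∃ R L : ℝ, ∀ t ∈ Set.Ico (T - h) T,
          ∀ x : EuclideanSpace ℝ (Fin 3), R ≤ ‖x‖ → ‖u t x‖ ≤ L := by
  sorry

/-- STUB 3 (OPEN — the content of the crux, localised at the lifespan; hardest).  **Near-field slow
production of a maximal solution.**  For `ν, T > 0` and a MAXIMAL smooth solution `(u,p)` with
lifespan `T` (`IsMaximalSmoothSolution ν 0 u p T`: classical on `[0,T)`, no smooth extension past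
`T`) that is Leray–Hopf from its rapidly decaying datum, every level `l > 0`, layer `h ∈ (0,T)` and
radius `R`: there is `C` such that for all `t < T` the production is integrable on the slow class
inside the near-field final layer — `0 < s < t`, `|u(s,x)| ≤ l`, `s ≥ T − h`, `‖x‖ < R` — with
`∫ |P| ≤ C`.  Equivalent (compactness of `B̄(0,R)`) to its GERM form: every `x₀` has `ρ > 0` and
`C` with `∫∫_{S_t ∩ [T−h,T)×B(x₀,ρ)} |P| ≤ C` for all `t < T`; trivial at regular points `(x₀,T)`,
so only the (nonempty, compact, `𝒫¹`-null) singular set at the blow-up time `T` matters.  Why it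
might fail: exactly why the crux might — a critical a-priori statement (`EnergySupercriticality`);
absolute value forgoes cancellations inside the slow class.  Attack (ideator cards
`type-one-stagnation-census`, `hyperfast-shadow-germ`, and the census): at a Type-I singular point
zoom to the ancient limits and bound `∫_{|U| ≤ ε} |P_U| ≤ C ε^{β}`, `β ≥ 2`, through the zero-set
strata of the space-analytic profile — production vanishes identically where `∇U` has rank ≤ 1
(stagnation sheets are shear; `|P| ≤ (4/3)‖∇u‖_F‖cof ∇u‖_F`); the Type-II branch is the residual.
[CKN1982, Seregin2014, KNSS2009, Constantin1990, Hou2022PotentiallySingularNS] -/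
theorem stub_nearFieldSlowProductionMaximal :
    ∀ (ν T : ℝ), 0 < ν → 0 < T →
      ∀ (u : ℝ → EuclideanSpace ℝ (Fin 3) → EuclideanSpace ℝ (Fin 3))
        (p : ℝ → EuclideanSpace ℝ (Fin 3) → ℝ),
        Literature.Analysis.FluidPDE.IsMaximalSmoothSolution ν 0 u p T →
        Literature.Analysis.FluidPDE.IsLerayHopfOn T ν 0 (u 0) u →
        Literature.Analysis.FluidPDE.HasRapidSpatialDecay (u 0) →
        ∀ l : ℝ, 0 < l → ∀ h : ℝ, 0 < h → h < T → ∀ R : ℝ, ∃ C : ℝ, ∀ t ∈ Set.Ico 0 T,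
          MeasureTheory.IntegrableOn
            (fun z : ℝ × EuclideanSpace ℝ (Fin 3) =>
              inner ℝ (Literature.Analysis.FluidPDE.curl (u z.1) z.2)
                (fderiv ℝ (u z.1) z.2 (Literature.Analysis.FluidPDE.curl (u z.1) z.2)))
            ({z : ℝ × EuclideanSpace ℝ (Fin 3) | z.1 ∈ Set.Ioo 0 t ∧ ‖u z.1 z.2‖ ≤ l} ∩
              {z : ℝ × EuclideanSpace ℝ (Fin 3) | T - h ≤ z.1 ∧ ‖z.2‖ < R}) ∧
          ∫ z in ({z : ℝ × EuclideanSpace ℝ (Fin 3) | z.1 ∈ Set.Ioo 0 t ∧ ‖u z.1 z.2‖ ≤ l} ∩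
              {z : ℝ × EuclideanSpace ℝ (Fin 3) | T - h ≤ z.1 ∧ ‖z.2‖ < R}),
            |inner ℝ (Literature.Analysis.FluidPDE.curl (u z.1) z.2)
              (fderiv ℝ (u z.1) z.2 (Literature.Analysis.FluidPDE.curl (u z.1) z.2))| ≤ C := by
  sorry

/-! ## Glue (sorry-free) -/

section Glue

variable (u : ℝ → EuclideanSpace ℝ (Fin 3) → EuclideanSpace ℝ (Fin 3))

/-- The enstrophy-production density `⟪ω, ∇u ω⟫` at a space-time point (glue abbreviation). -/
private def production (z : ℝ × EuclideanSpace ℝ (Fin 3)) : ℝ :=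
  inner ℝ (Literature.Analysis.FluidPDE.curl (u z.1) z.2)
    (fderiv ℝ (u z.1) z.2 (Literature.Analysis.FluidPDE.curl (u z.1) z.2))

/-- The slow space-time class up to time `t` at level `l` (glue abbreviation). -/
private def slowSet (l t : ℝ) : Set (ℝ × EuclideanSpace ℝ (Fin 3)) :=
  {z : ℝ × EuclideanSpace ℝ (Fin 3) | z.1 ∈ Set.Ioo 0 t ∧ ‖u z.1 z.2‖ ≤ l}

variable {u}

/-- The early cut `{s < a}` is measurable. -/
private theorem measurableSet_early (a : ℝ) :
    MeasurableSet {z : ℝ × EuclideanSpace ℝ (Fin 3) | z.1 < a} :=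
  measurableSet_lt measurable_fst measurable_const

/-- The near-field cut `{‖x‖ < ρ}` is measurable. -/
private theorem measurableSet_near (ρ : ℝ) :
    MeasurableSet {z : ℝ × EuclideanSpace ℝ (Fin 3) | ‖z.2‖ < ρ} :=
  measurableSet_lt measurable_snd.norm measurable_const

/-- The early piece of the slow class sits in the slab `(0, a) × ℝ³`. -/
private theorem slow_inter_early_subset {l t a : ℝ} :
    slowSet u l t ∩ {z : ℝ × EuclideanSpace ℝ (Fin 3) | z.1 < a} ⊆
      Set.Ioo 0 a ×ˢ (Set.univ : Set (EuclideanSpace ℝ (Fin 3))) := by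
  rintro z ⟨⟨hzt, _⟩, hza⟩
  exact Set.mk_mem_prod ⟨hzt.1, hza⟩ (Set.mem_univ _)

/-- Beyond the early cut and inside the near-field cut: exactly the near-field final layer of the
slow class. -/
private theorem slow_sdiff_inter_near {l t a ρ : ℝ} :
    (slowSet u l t \ {z : ℝ × EuclideanSpace ℝ (Fin 3) | z.1 < a}) ∩
        {z : ℝ × EuclideanSpace ℝ (Fin 3) | ‖z.2‖ < ρ} =
      slowSet u l t ∩ {z : ℝ × EuclideanSpace ℝ (Fin 3) | a ≤ z.1 ∧ ‖z.2‖ < ρ} := by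
  ext z
  simp only [slowSet, Set.mem_inter_iff, Set.mem_sdiff, Set.mem_setOf_eq, not_lt]
  tauto

/-- Beyond the early cut and outside the near-field cut: late far-field slow points. -/
private theorem mem_slow_sdiff_sdiff_near {l t a ρ : ℝ} {z : ℝ × EuclideanSpace ℝ (Fin 3)}
    (hz : z ∈ (slowSet u l t \ {z : ℝ × EuclideanSpace ℝ (Fin 3) | z.1 < a}) \
        {z : ℝ × EuclideanSpace ℝ (Fin 3) | ‖z.2‖ < ρ}) :
    z.1 ∈ Set.Ioo 0 t ∧ a ≤ z.1 ∧ ρ ≤ ‖z.2‖ := by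
  obtain ⟨⟨⟨hzt, _⟩, hza⟩, hzR⟩ := hz
  simp only [Set.mem_setOf_eq, not_lt] at hza hzR
  exact ⟨hzt, hza, hzR⟩

/-- A point of the closed `r`-ball around `x` with `R + r ≤ ‖x‖` lies outside the open `R`-ball. -/
private theorem le_norm_of_mem_closedBall {x y : EuclideanSpace ℝ (Fin 3)} {R r : ℝ}
    (hx : R + r ≤ ‖x‖) (hy : y ∈ Metric.closedBall x r) : R ≤ ‖y‖ := by
  rw [Metric.mem_closedBall, dist_comm, dist_eq_norm] at hy
  have h := norm_sub_norm_le x y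
  linarith

end Glue

/-- **Composition in the maximal case, hypothesis form (real proof, no `sorry`).**  The three stub
STATEMENTS imply the crux statement restricted to maximal smooth solutions (the right-hand side of
`slowClassProduction_iff_maximal`), written out verbatim. -/
theorem maximalCase_of_stubs
    (h₂ : ∀ (ν T : ℝ), 0 < ν → 0 < T →
      ∀ (u : ℝ → EuclideanSpace ℝ (Fin 3) → EuclideanSpace ℝ (Fin 3))
        (p : ℝ → EuclideanSpace ℝ (Fin 3) → ℝ),
        Literature.Analysis.FluidPDE.IsClassicalNSSolutionOn (Set.Ico 0 T) ν 0 u p →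
        Literature.Analysis.FluidPDE.IsLerayHopfOn T ν 0 (u 0) u →
        Literature.Analysis.FluidPDE.HasRapidSpatialDecay (u 0) →
        ∀ K : ℝ, ∃ C : ℝ, ∀ E : Set (ℝ × EuclideanSpace ℝ (Fin 3)),
          (∀ z ∈ E, z.1 ∈ Set.Ioo 0 T ∧ ‖Literature.Analysis.FluidPDE.curl (u z.1) z.2‖ ≤ K) →
            MeasureTheory.IntegrableOn
              (fun z : ℝ × EuclideanSpace ℝ (Fin 3) =>
                inner ℝ (Literature.Analysis.FluidPDE.curl (u z.1) z.2)
                  (fderiv ℝ (u z.1) z.2 (Literature.Analysis.FluidPDE.curl (u z.1) z.2))) E ∧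
            ∫ z in E, |inner ℝ (Literature.Analysis.FluidPDE.curl (u z.1) z.2)
                (fderiv ℝ (u z.1) z.2 (Literature.Analysis.FluidPDE.curl (u z.1) z.2))| ≤ C)
    (h₃ : ∀ (ν T : ℝ), 0 < ν → 0 < T →
      ∀ (u : ℝ → EuclideanSpace ℝ (Fin 3) → EuclideanSpace ℝ (Fin 3))
        (p : ℝ → EuclideanSpace ℝ (Fin 3) → ℝ),
        Literature.Analysis.FluidPDE.IsClassicalNSSolutionOn (Set.Ico 0 T) ν 0 u p →
        Literature.Analysis.FluidPDE.IsLerayHopfOn T ν 0 (u 0) u →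
        Literature.Analysis.FluidPDE.HasRapidSpatialDecay (u 0) →
        ∃ h : ℝ, 0 < h ∧ h < T ∧ ∃ R L : ℝ, ∀ t ∈ Set.Ico (T - h) T,
          ∀ x : EuclideanSpace ℝ (Fin 3), R ≤ ‖x‖ → ‖u t x‖ ≤ L)
    (h₄ : ∀ (ν T : ℝ), 0 < ν → 0 < T →
      ∀ (u : ℝ → EuclideanSpace ℝ (Fin 3) → EuclideanSpace ℝ (Fin 3))
        (p : ℝ → EuclideanSpace ℝ (Fin 3) → ℝ),
        Literature.Analysis.FluidPDE.IsMaximalSmoothSolution ν 0 u p T →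
        Literature.Analysis.FluidPDE.IsLerayHopfOn T ν 0 (u 0) u →
        Literature.Analysis.FluidPDE.HasRapidSpatialDecay (u 0) →
        ∀ l : ℝ, 0 < l → ∀ h : ℝ, 0 < h → h < T → ∀ R : ℝ, ∃ C : ℝ, ∀ t ∈ Set.Ico 0 T,
          MeasureTheory.IntegrableOn
            (fun z : ℝ × EuclideanSpace ℝ (Fin 3) =>
              inner ℝ (Literature.Analysis.FluidPDE.curl (u z.1) z.2)
                (fderiv ℝ (u z.1) z.2 (Literature.Analysis.FluidPDE.curl (u z.1) z.2)))
            ({z : ℝ × EuclideanSpace ℝ (Fin 3) | z.1 ∈ Set.Ioo 0 t ∧ ‖u z.1 z.2‖ ≤ l} ∩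
              {z : ℝ × EuclideanSpace ℝ (Fin 3) | T - h ≤ z.1 ∧ ‖z.2‖ < R}) ∧
          ∫ z in ({z : ℝ × EuclideanSpace ℝ (Fin 3) | z.1 ∈ Set.Ioo 0 t ∧ ‖u z.1 z.2‖ ≤ l} ∩
              {z : ℝ × EuclideanSpace ℝ (Fin 3) | T - h ≤ z.1 ∧ ‖z.2‖ < R}),
            |inner ℝ (Literature.Analysis.FluidPDE.curl (u z.1) z.2)
              (fderiv ℝ (u z.1) z.2 (Literature.Analysis.FluidPDE.curl (u z.1) z.2))| ≤ C) :
    ∀ (ν T : ℝ), 0 < ν → 0 < T →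
      ∀ (u : ℝ → EuclideanSpace ℝ (Fin 3) → EuclideanSpace ℝ (Fin 3))
        (p : ℝ → EuclideanSpace ℝ (Fin 3) → ℝ),
        Literature.Analysis.FluidPDE.IsMaximalSmoothSolution ν 0 u p T →
        Literature.Analysis.FluidPDE.IsLerayHopfOn T ν 0 (u 0) u →
        Literature.Analysis.FluidPDE.HasRapidSpatialDecay (u 0) →
        ∀ l : ℝ, 0 < l → ∃ C : ℝ, ∀ t ∈ Set.Ico 0 T,
          MeasureTheory.IntegrableOn
            (fun z : ℝ × EuclideanSpace ℝ (Fin 3) =>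
              inner ℝ (Literature.Analysis.FluidPDE.curl (u z.1) z.2)
                (fderiv ℝ (u z.1) z.2 (Literature.Analysis.FluidPDE.curl (u z.1) z.2)))
            {z : ℝ × EuclideanSpace ℝ (Fin 3) | z.1 ∈ Set.Ioo 0 t ∧ ‖u z.1 z.2‖ ≤ l} ∧
          ∫ z in {z : ℝ × EuclideanSpace ℝ (Fin 3) | z.1 ∈ Set.Ioo 0 t ∧ ‖u z.1 z.2‖ ≤ l},
            inner ℝ (Literature.Analysis.FluidPDE.curl (u z.1) z.2)
              (fderiv ℝ (u z.1) z.2 (Literature.Analysis.FluidPDE.curl (u z.1) z.2)) ≤ C := by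
  intro ν T hν hT u p hmax hLH hdec l hl
  have hcl : Literature.Analysis.FluidPDE.IsClassicalNSSolutionOn (Set.Ico 0 T) ν 0 u p := hmax.1
  -- far-field data
  obtain ⟨h, hh0, hhT, R, L, hfar⟩ := h₃ ν T hν hT u p hcl hLH hdec
  -- the cylinder radius `r` with `r² / ν = h / 2`
  set r : ℝ := Real.sqrt (ν * (h / 2)) with hr_def
  have hνh : 0 ≤ ν * (h / 2) := by positivity
  have hr0 : 0 < r := Real.sqrt_pos.mpr (by positivity)
  have hr2 : r ^ 2 / ν = h / 2 := by
    rw [hr_def, Real.sq_sqrt hνh]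
    field_simp
  -- finite dissipation and Serrin's quantitative vorticity bound at level `L`, radius `r`
  have hD := (Literature.Analysis.FluidPDE.IsLerayHopfOn.lintegral_frobeniusNormSq_fderiv_of_classical
    hcl hLH hT).1
  obtain ⟨K, hK⟩ :=
    _root_.Summit.NavierStokesRegularity.NavierStokesRegularity.Theorems.SlowClassProduction.Birth.norm_curl_le_of_slow_cylinder
      ν T hν u p hcl hD L r hr0
  -- the three budgets
  obtain ⟨C₂, hbdd⟩ := h₂ ν T hν hT u p hcl hLH hdec K
  have hh20 : 0 < h / 2 := by positivity
  have hh2T : h / 2 < T := by linarith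
  obtain ⟨C₄, hnear⟩ := h₄ ν T hν hT u p hmax hLH hdec l hl (h / 2) hh20 hh2T (R + r)
  have hTh0 : 0 < T - h / 2 := by linarith
  have hThT : T - h / 2 < T := by linarith
  have hI : IntegrableOn (production u)
      (Set.Ioo 0 (T - h / 2) ×ˢ (Set.univ : Set (EuclideanSpace ℝ (Fin 3)))) :=
    _root_.Summit.NavierStokesRegularity.NavierStokesRegularity.Theorems.SlowClassProduction.Birth.stub_slabProduction
      ν T hν hT u p hcl hLH hdec (T - h / 2) hTh0 hThT
  refine ⟨(∫ z in Set.Ioo 0 (T - h / 2) ×ˢ (Set.univ : Set (EuclideanSpace ℝ (Fin 3))),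
      |production u z|) + C₄ + C₂, ?_⟩
  intro t ht
  change IntegrableOn (production u) (slowSet u l t) ∧ ∫ z in slowSet u l t, production u z ≤ _
  -- the two measurable cuts
  set A : Set (ℝ × EuclideanSpace ℝ (Fin 3)) := {z | z.1 < T - h / 2} with hAdef
  set B : Set (ℝ × EuclideanSpace ℝ (Fin 3)) := {z | ‖z.2‖ < R + r} with hBdef
  have hA : MeasurableSet A := measurableSet_early (T - h / 2)
  have hB : MeasurableSet B := measurableSet_near (R + r)
  -- piece 1: early, inside the slab `(0, T - h/2) × ℝ³`
  have hsub : slowSet u l t ∩ A ⊆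
      Set.Ioo 0 (T - h / 2) ×ˢ (Set.univ : Set (EuclideanSpace ℝ (Fin 3))) :=
    slow_inter_early_subset
  have hIA : IntegrableOn (production u) (slowSet u l t ∩ A) := hI.mono_set hsub
  -- piece 2: late near field = the open stub's set
  have hNt : IntegrableOn (production u)
      (slowSet u l t ∩ {z : ℝ × EuclideanSpace ℝ (Fin 3) | T - h / 2 ≤ z.1 ∧ ‖z.2‖ < R + r}) ∧
      ∫ z in slowSet u l t ∩ {z : ℝ × EuclideanSpace ℝ (Fin 3) | T - h / 2 ≤ z.1 ∧ ‖z.2‖ < R + r},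
        |production u z| ≤ C₄ := hnear t ht
  have hNeq : (slowSet u l t \ A) ∩ B =
      slowSet u l t ∩ {z : ℝ × EuclideanSpace ℝ (Fin 3) | T - h / 2 ≤ z.1 ∧ ‖z.2‖ < R + r} :=
    slow_sdiff_inter_near
  have hIN : IntegrableOn (production u) ((slowSet u l t \ A) ∩ B) := by
    rw [hNeq]; exact hNt.1
  -- piece 3: late far field — every backward `(h/2, r)`-cylinder is slow at level `L`, so `‖ω‖ ≤ K`
  have hFhyp : ∀ z ∈ (slowSet u l t \ A) \ B,
      z.1 ∈ Set.Ioo 0 T ∧ ‖Literature.Analysis.FluidPDE.curl (u z.1) z.2‖ ≤ K := by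
    intro z hz
    obtain ⟨hzt, hza, hzR⟩ := mem_slow_sdiff_sdiff_near hz
    have hz1T : z.1 < T := lt_trans hzt.2 ht.2
    refine ⟨⟨hzt.1, hz1T⟩, hK z.1 ?_ hz1T z.2 ?_⟩
    · rw [hr2]; linarith
    · intro σ hσ y hy
      refine hfar σ ⟨?_, ?_⟩ y (le_norm_of_mem_closedBall hzR hy)
      · have h1 := hσ.1
        rw [hr2] at h1
        linarith
      · exact lt_of_le_of_lt hσ.2 hz1T
  have hFt : IntegrableOn (production u) ((slowSet u l t \ A) \ B) ∧
      ∫ z in (slowSet u l t \ A) \ B, |production u z| ≤ C₂ := hbdd _ hFhyp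
  -- integrability on the whole slow class
  have hSA : IntegrableOn (production u) (slowSet u l t \ A) := by
    rw [← Set.inter_union_sdiff (slowSet u l t \ A) B]
    exact hIN.union hFt.1
  have hS : IntegrableOn (production u) (slowSet u l t) := by
    rw [← Set.inter_union_sdiff (slowSet u l t) A]
    exact hIA.union hSA
  refine ⟨hS, ?_⟩
  -- split the integral twice
  have e1 := integral_inter_add_sdiff hA hS
  have e2 := integral_inter_add_sdiff hB hSA
  -- bound the three pieces
  have b0 : ∫ z in slowSet u l t ∩ A, production u z ≤
      ∫ z in Set.Ioo 0 (T - h / 2) ×ˢ (Set.univ : Set (EuclideanSpace ℝ (Fin 3))), |production u z| :=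
    calc ∫ z in slowSet u l t ∩ A, production u z
        ≤ ∫ z in slowSet u l t ∩ A, |production u z| :=
          integral_mono hIA hIA.abs fun z => le_abs_self _
      _ ≤ ∫ z in Set.Ioo 0 (T - h / 2) ×ˢ (Set.univ : Set (EuclideanSpace ℝ (Fin 3))),
            |production u z| :=
          setIntegral_mono_set hI.abs (ae_of_all _ fun z => abs_nonneg _) hsub.eventuallyLE
  have b1 : ∫ z in (slowSet u l t \ A) ∩ B, production u z ≤ C₄ := by
    rw [hNeq]
    exact le_trans (integral_mono hNt.1 hNt.1.abs fun z => le_abs_self _) hNt.2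
  have b2 : ∫ z in (slowSet u l t \ A) \ B, production u z ≤ C₂ :=
    le_trans (integral_mono hFt.1 hFt.1.abs fun z => le_abs_self _) hFt.2
  rw [← e1, ← e2]
  linarith

/-- **The skeleton: the crux BY NAME from the three declared stubs** (A12 layer invariant — no
`Prop` hypotheses; the placeholders live only inside `stub_curlBoundedProduction`,
`stub_farFieldVelocity`, `stub_nearFieldSlowProductionMaximal`, used by name; the composition
`maximalCase_of_stubs` and the tree's `slowClassProduction_iff_maximal` are closed). -/
theorem SlowClassProduction_of :
    _root_.Summit.NavierStokesRegularity.NavierStokesRegularity.Theses.HodographBetchov.SlowClassProduction :=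
  _root_.Summit.NavierStokesRegularity.NavierStokesRegularity.Theorems.SlowClassProduction.slowClassProduction_iff_maximal.mpr
    (maximalCase_of_stubs stub_curlBoundedProduction stub_farFieldVelocity
      stub_nearFieldSlowProductionMaximal)

end Summit.NavierStokesRegularity.NavierStokesRegularity.Cruxes.SlowClassProduction.NearField
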